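import Literature.InformationTheory.Entropy.WeakMonotonicityFromRelEntropy
import HarnessLib

/-!
# The entropy increment of a window state is nonnegative under translation invariance
# (Fawzi–Fawzi–Scalet 2024, Theorem 4.1: `LocTI_{2l−1} ⊂ WMTI_l`) — site-indexed (spin-system) form

Topic `MathematicalPhysics/QuantumLattice` (family `hubbard`; serves the sr-mbsolver ENT lever: the
transport of entropy-constrained (`WMTI_k`) relaxation certificates, where the feasible point — the
window marginal of a translation-invariant state — must satisfy `S(ρ_{[1,l]}) − S(ρ_{[1,l−1]}) ≥ 0`).

Fawzi–Fawzi–Scalet, proof of Theorem 4.1 (first inclusion `LocTI_{2l−1} ⊂ WMTI_l`): for the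
marginals of ONE state on the `(2l−1)`-site window `[1, 2l−1]`, "We know from weak monotonicity that
`S(l|1…l−1) + S(l|l+1…2l−1) ≥ 0`. However, translation-invariance tells us that
`S(l|l+1…2l−1) = S(l…2l−1) − S(l+1…2l−1) = S(1…l) − S(1…l−1) = S(l|1…l−1)`, so
`2 S(l|1…l−1) ≥ 0`." Weak monotonicity (Lemma 2.1 there; Lieb–Ruskai) is the tree THEOREM
`Literature.InformationTheory.Entropy.weak_monotonicity_holds`, stated on product-indexed matrices
`X × S × Y`; the arithmetic step is the tree's `entropy_increment_nonneg_of_weak_monotonicity`. This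
file moves them to SITE-INDEXED window states `σ : Op Y q` (`TensorIndex Y q = Y → Fin q`) and their
`spinPartialTrace` marginals, which is the form the lattice transports use:

* `spinPartialTrace_inl_apply`, `spinPartialTrace_inr_apply` — entries of the marginals along the block
  embeddings `Sum.inl : X ↪ X ⊕ C`, `Sum.inr : C ↪ X ⊕ C` (pattern of `spinPartialTrace_succEmb_apply`);
* `configSplit3`, `toProd3` and the four identities `spinPartialTrace_inl_eq_traceRight_traceLast`,
  `spinPartialTrace_embAS_eq_traceLast`, `spinPartialTrace_inr_eq_traceLeft`,
  `spinPartialTrace_embB_eq_traceLeft_traceLeft` — on the three-block site type `A ⊕ (S ⊕ B)` the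
  window marginals ARE the product-coordinate marginals `traceLast`, `traceLeft`, … of
  `VonNeumannEntropyInequalities` / `QuantumMarginals` (up to the configuration split);
* **`entropy_increment_nonneg_of_shift_invariant`** — for a density `σ` on `A ⊕ (S ⊕ B)` with
  `S(σ_{SB}) = S(σ_{AS})` and `S(σ_B) = S(σ_A)`: `0 ≤ S(σ_{AS}) − S(σ_A)`;
* **`entropy_increment_nonneg_of_shift_invariant'`** — the same for a state on ANY site type `Y`
  identified with a three-block window by a site bijection `ε : Y ≃ A ⊕ (S ⊕ B)` (the sub-windows given
  by four site embeddings that `ε` carries to the standard blocks), via `reindexOp` /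
  `spinPartialTrace_equiv` / `spinPartialTrace_trans` and `vonNeumannEntropy_reindexOp`;
* **`entropy_increment_nonneg_of_shift_invariant_fin`** — the chain form on the `Fin (n + 1 + n)`-indexed
  window with the four sub-window embeddings `finFirst n` (sites `0…n−1`), `finFirstSucc n` (`0…n`),
  `finLastSucc n` (`n…2n`), `finLast n` (`n+1…2n`) and their value formulas (`finFirstSucc_apply`,
  `finFirst_apply`, `finLast_apply`, `coe_finLastSucc_apply`).

No definition of mathematical content and no named fact is introduced (`configSplit3`, `toProd3`,
`embAS`, `embB` are coordinate bookkeeping).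

## References

* H. Fawzi, O. Fawzi, S. O. Scalet, *Entropy constraints for ground energy optimization*,
  J. Math. Phys. 65, 032201 (2024) = arXiv:2305.06855, Lemma 2.1, Theorem 4.1 and its proof (§4).
  [FawziFawziScalet2024Entropy]
* M. A. Nielsen, I. L. Chuang, *Quantum Computation and Quantum Information* (CUP 2010), §2.4.3
  eq. (2.178) (partial trace), Theorem 11.14 eq. (11.107) p.521. [NielsenChuang2010]
* E. H. Lieb, M. B. Ruskai, J. Math. Phys. 14 (1973) 1938–1941. [LiebRuskai1973]
-/

noncomputable section

open Matrix
open scoped BigOperators ComplexOrder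

namespace Literature.MathematicalPhysics.QuantumLattice

open Literature.Computability.QuantumComplexity (traceLeft traceRight IsDensity traceLeft_apply
  traceRight_apply)
open Literature.InformationTheory.Entropy (vonNeumannEntropy traceLast traceLast_apply
  weak_monotonicity_holds entropy_increment_nonneg_of_weak_monotonicity vonNeumannEntropy_submatrix_equiv)

variable {A S B C X : Type} [Fintype A] [DecidableEq A] [Fintype S] [DecidableEq S] [Fintype B]
  [DecidableEq B] [Fintype C] [DecidableEq C] [Fintype X] [DecidableEq X] {q : ℕ}

/-! ### Entries of the partial trace along `Sum.inl` / `Sum.inr` -/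

omit [Fintype C] [DecidableEq C] [Fintype X] [DecidableEq X] in
/-- Off the range of `Sum.inl` two configurations agree iff their `inr` parts agree. [folklore] -/
private theorem agree_off_range_inl_iff (σ τ : X ⊕ C → Fin q) :
    (∀ y, y ∉ Set.range (⇑(Function.Embedding.inl : X ↪ X ⊕ C)) → σ y = τ y) ↔
      (∀ c, σ (Sum.inr c) = τ (Sum.inr c)) := by
  constructor
  · intro h c
    exact h (Sum.inr c) (by rintro ⟨x, hx⟩; exact Sum.inl_ne_inr hx)
  · intro h y hy
    rcases y with x | c
    · exact absurd ⟨x, rfl⟩ hy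
    · exact h c

omit [Fintype C] [DecidableEq C] [Fintype X] [DecidableEq X] in
/-- Off the range of `Sum.inr` two configurations agree iff their `inl` parts agree. [folklore] -/
private theorem agree_off_range_inr_iff (σ τ : X ⊕ C → Fin q) :
    (∀ y, y ∉ Set.range (⇑(Function.Embedding.inr : C ↪ X ⊕ C)) → σ y = τ y) ↔
      (∀ x, σ (Sum.inl x) = τ (Sum.inl x)) := by
  constructor
  · intro h x
    exact h (Sum.inl x) (by rintro ⟨c, hc⟩; exact Sum.inr_ne_inl hc)
  · intro h y hy
    rcases y with x | c
    · exact h x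
    · exact absurd ⟨c, rfl⟩ hy

/-- Double sums over configurations of `X ⊕ C`, split as (`X`-part, `C`-part). [folklore] -/
private theorem sum_sum_elim (G : (X ⊕ C → Fin q) → (X ⊕ C → Fin q) → ℂ) :
    ∑ σ, ∑ τ, G σ τ = ∑ a : X → Fin q, ∑ c : C → Fin q, ∑ b : X → Fin q, ∑ d : C → Fin q,
      G (Sum.elim a c) (Sum.elim b d) := by
  rw [← (Equiv.sumArrowEquivProdArrow X C (Fin q)).symm.sum_comp, Fintype.sum_prod_type]
  refine Finset.sum_congr rfl fun a _ => Finset.sum_congr rfl fun c _ => ?_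
  rw [← (Equiv.sumArrowEquivProdArrow X C (Fin q)).symm.sum_comp, Fintype.sum_prod_type]
  rfl

/-- **Tracing out the `inr` block**: `(tr_C σ)_{ts} = Σ_c σ_{(t,c),(s,c)}` along `Sum.inl : X ↪ X ⊕ C`.
[cite: NielsenChuang2010, §2.4.3 eq. (2.178)] -/
theorem spinPartialTrace_inl_apply (σ : Op (X ⊕ C) q) (t s : TensorIndex X q) :
    spinPartialTrace (Function.Embedding.inl : X ↪ X ⊕ C) σ t s =
      ∑ c : TensorIndex C q, σ (Sum.elim t c) (Sum.elim s c) := by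
  rw [spinPartialTrace_apply, Matrix.trace]
  simp only [Matrix.diag_apply, Matrix.mul_apply, spinEmbed_apply, Function.Embedding.inl_apply,
    agree_off_range_inl_iff, Matrix.single_apply]
  rw [sum_sum_elim]
  simp only [Sum.elim_inl, Sum.elim_inr, ← funext_iff, ite_and, ite_mul, one_mul, zero_mul,
    Finset.sum_ite_irrel, Finset.sum_const_zero, Finset.sum_ite_eq, Finset.mem_univ, if_true]

/-- **Tracing out the `inl` block**: `(tr_X σ)_{ts} = Σ_a σ_{(a,t),(a,s)}` along `Sum.inr : C ↪ X ⊕ C`.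
[cite: NielsenChuang2010, §2.4.3 eq. (2.178)] -/
theorem spinPartialTrace_inr_apply (σ : Op (X ⊕ C) q) (t s : TensorIndex C q) :
    spinPartialTrace (Function.Embedding.inr : C ↪ X ⊕ C) σ t s =
      ∑ a : TensorIndex X q, σ (Sum.elim a t) (Sum.elim a s) := by
  rw [spinPartialTrace_apply, Matrix.trace]
  simp only [Matrix.diag_apply, Matrix.mul_apply, spinEmbed_apply, Function.Embedding.inr_apply,
    agree_off_range_inr_iff, Matrix.single_apply]
  rw [sum_sum_elim]
  simp only [Sum.elim_inl, Sum.elim_inr, ← funext_iff, ite_and, ite_mul, one_mul, zero_mul,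
    Finset.sum_ite_irrel, Finset.sum_const_zero, Finset.sum_ite_eq, Finset.mem_univ, if_true]

/-! ### The three-block window `A ⊕ (S ⊕ B)`: configuration split and the four marginals -/

/-- The configuration space of the three-block window as a triple product:
`k ↦ (k|_A, k|_S, k|_B)` (the tensor-product structure `ℋ_A ⊗ ℋ_S ⊗ ℋ_B` of the window).
[cite: NielsenChuang2010, §2.4.3 eq. (2.178)] -/
def configSplit3 (A S B : Type) (q : ℕ) :
    TensorIndex (A ⊕ (S ⊕ B)) q ≃ TensorIndex A q × TensorIndex S q × TensorIndex B q :=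
  (Equiv.sumArrowEquivProdArrow A (S ⊕ B) (Fin q)).trans
    (Equiv.prodCongr (Equiv.refl _) (Equiv.sumArrowEquivProdArrow S B (Fin q)))

omit [Fintype A] [DecidableEq A] [Fintype S] [DecidableEq S] [Fintype B] [DecidableEq B] in
/-- `configSplit3⁻¹ (a, c, b) = a ⊕ (c ⊕ b)`. [cite: NielsenChuang2010, §2.4.3 eq. (2.178)] -/
@[simp] theorem configSplit3_symm_apply (a : TensorIndex A q) (c : TensorIndex S q) (b : TensorIndex B q) :
    (configSplit3 A S B q).symm (a, c, b) = Sum.elim a (Sum.elim c b) := rfl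

/-- The window state in triple-product coordinates (a reindexing of `σ`). [cite: NielsenChuang2010, §2.4.3 eq. (2.178)] -/
def toProd3 (σ : Op (A ⊕ (S ⊕ B)) q) :
    Matrix (TensorIndex A q × TensorIndex S q × TensorIndex B q)
      (TensorIndex A q × TensorIndex S q × TensorIndex B q) ℂ :=
  σ.submatrix (configSplit3 A S B q).symm (configSplit3 A S B q).symm

/-- The embedding of the first two blocks `A ⊕ S ↪ A ⊕ (S ⊕ B)` (sub-window `[1, l]` of `[1, 2l−1]`).
[cite: FawziFawziScalet2024Entropy, Theorem 4.1 (proof)] -/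
def embAS (A S B : Type) : A ⊕ S ↪ A ⊕ (S ⊕ B) :=
  (Function.Embedding.inl : A ⊕ S ↪ (A ⊕ S) ⊕ B).trans (Equiv.sumAssoc A S B).toEmbedding

/-- The embedding of the last block `B ↪ A ⊕ (S ⊕ B)` (sub-window `[l+1, 2l−1]`).
[cite: FawziFawziScalet2024Entropy, Theorem 4.1 (proof)] -/
def embB (A S B : Type) : B ↪ A ⊕ (S ⊕ B) :=
  (Function.Embedding.inr : B ↪ S ⊕ B).trans (Function.Embedding.inr : S ⊕ B ↪ A ⊕ (S ⊕ B))

/-- (m2) The `A`-marginal is `Tr_S Tr_B` in product coordinates. [cite: NielsenChuang2010, §2.4.3 eq. (2.178)] -/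
theorem spinPartialTrace_inl_eq_traceRight_traceLast (σ : Op (A ⊕ (S ⊕ B)) q) :
    spinPartialTrace (Function.Embedding.inl : A ↪ A ⊕ (S ⊕ B)) σ = traceRight (traceLast (toProd3 σ)) := by
  ext t s
  rw [spinPartialTrace_inl_apply, traceRight_apply]
  simp only [traceLast_apply, toProd3, Matrix.submatrix_apply, configSplit3_symm_apply]
  rw [← (Equiv.sumArrowEquivProdArrow S B (Fin q)).symm.sum_comp, Fintype.sum_prod_type]
  rfl

/-- (m4) The `B`-marginal is `Tr_A Tr_S` in product coordinates. [cite: NielsenChuang2010, §2.4.3 eq. (2.178)] -/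
theorem spinPartialTrace_embB_eq_traceLeft_traceLeft (σ : Op (A ⊕ (S ⊕ B)) q) :
    spinPartialTrace (embB A S B) σ = traceLeft (traceLeft (toProd3 σ)) := by
  rw [embB, spinPartialTrace_trans]
  ext t s
  rw [spinPartialTrace_inr_apply, traceLeft_apply]
  simp only [spinPartialTrace_inr_apply, traceLeft_apply, toProd3, Matrix.submatrix_apply,
    configSplit3_symm_apply]

omit [Fintype A] [DecidableEq A] [Fintype S] [DecidableEq S] [Fintype B] [DecidableEq B] in
/-- Reassociating a configuration: `(u ⊕ c) ∘ sumAssoc⁻¹ = u|_A ⊕ (u|_S ⊕ c)`. [folklore] -/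
private theorem elim_comp_sumAssoc_symm (u : A ⊕ S → Fin q) (c : B → Fin q) :
    (fun x => Sum.elim u c ((Equiv.sumAssoc A S B).symm x)) =
      Sum.elim (fun a => u (Sum.inl a)) (Sum.elim (fun s => u (Sum.inr s)) c) := by
  funext x
  rcases x with a | s | b <;> rfl

/-- (m1) The `A ⊕ S`-marginal is `Tr_B` in product coordinates (after splitting `A ⊕ S` configurations).
[cite: NielsenChuang2010, §2.4.3 eq. (2.178)] -/
theorem spinPartialTrace_embAS_eq_traceLast (σ : Op (A ⊕ (S ⊕ B)) q) :
    spinPartialTrace (embAS A S B) σ =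
      (traceLast (toProd3 σ)).submatrix (Equiv.sumArrowEquivProdArrow A S (Fin q))
        (Equiv.sumArrowEquivProdArrow A S (Fin q)) := by
  rw [embAS, spinPartialTrace_trans, spinPartialTrace_equiv]
  ext u v
  rw [spinPartialTrace_inl_apply, Matrix.submatrix_apply]
  simp only [reindexOp_apply, toProd3]
  refine Finset.sum_congr rfl fun c _ => ?_
  rw [elim_comp_sumAssoc_symm, elim_comp_sumAssoc_symm]
  rfl

/-- (m3) The `S ⊕ B`-marginal is `Tr_A` in product coordinates (after splitting `S ⊕ B` configurations).
[cite: NielsenChuang2010, §2.4.3 eq. (2.178)] -/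
theorem spinPartialTrace_inr_eq_traceLeft (σ : Op (A ⊕ (S ⊕ B)) q) :
    spinPartialTrace (Function.Embedding.inr : S ⊕ B ↪ A ⊕ (S ⊕ B)) σ =
      (traceLeft (toProd3 σ)).submatrix (Equiv.sumArrowEquivProdArrow S B (Fin q))
        (Equiv.sumArrowEquivProdArrow S B (Fin q)) := by
  ext u v
  rw [spinPartialTrace_inr_apply, Matrix.submatrix_apply]
  simp only [traceLeft_apply, toProd3, Matrix.submatrix_apply]
  refine Finset.sum_congr rfl fun a _ => ?_
  congr 1 <;> (funext x; rcases x with a' | s | b <;> rfl)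

/-! ### The theorem -/

/-- **Nonnegativity of the entropy increment under (local) translation invariance**
(Fawzi–Fawzi–Scalet 2024, proof of Theorem 4.1, first inclusion, spin-system form). Let `σ` be a
density matrix of a three-block window `A ⊕ (S ⊕ B)` (think `A = [1, l−1]`, `S = {l}`,
`B = [l+1, 2l−1]` of a chain) whose marginals on the two `l`-site sub-windows `A ⊕ S`, `S ⊕ B`
have equal entropy and whose marginals on `A` and `B` have equal entropy (for the window marginal of
a translation-invariant chain state both pairs are even unitarily equivalent). Then the conditional
entropy `S(l | 1…l−1) = S(σ_{AS}) − S(σ_A)` is nonnegative: "We know from weak monotonicity that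
`S(l|1…l−1) + S(l|l+1…2l−1) ≥ 0`. However, translation-invariance tells us that
`S(l|l+1…2l−1) = … = S(l|1…l−1)`, so `2 S(l|1…l−1) ≥ 0`." Weak monotonicity is the tree
THEOREM `weak_monotonicity_holds` (Lieb–Ruskai); this file only moves it from product coordinates
`X × S × Y` to site-indexed window states (`spinPartialTrace` marginals).
[cite: FawziFawziScalet2024Entropy, Theorem 4.1 (proof) and Lemma 2.1]
[cite: NielsenChuang2010, Theorem 11.14 eq. (11.107) p.521] -/
theorem entropy_increment_nonneg_of_shift_invariant (σ : Op (A ⊕ (S ⊕ B)) q) (hσ : σ.PosSemidef)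
    (htr : σ.trace = 1)
    (hAS : vonNeumannEntropy (spinPartialTrace (Function.Embedding.inr : S ⊕ B ↪ A ⊕ (S ⊕ B)) σ) =
      vonNeumannEntropy (spinPartialTrace (embAS A S B) σ))
    (hB : vonNeumannEntropy (spinPartialTrace (embB A S B) σ) =
      vonNeumannEntropy (spinPartialTrace (Function.Embedding.inl : A ↪ A ⊕ (S ⊕ B)) σ)) :
    0 ≤ vonNeumannEntropy (spinPartialTrace (embAS A S B) σ) -
      vonNeumannEntropy (spinPartialTrace (Function.Embedding.inl : A ↪ A ⊕ (S ⊕ B)) σ) := by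
  have hρ : IsDensity (toProd3 σ) := by
    refine ⟨hσ.submatrix _, ?_⟩
    rw [toProd3, Literature.MathematicalPhysics.QuantumLattice.trace_submatrix_equiv_equiv, htr]
  have hH3 : (traceLast (toProd3 σ)).IsHermitian := (posSemidef_traceRight (hρ.1.submatrix _)).isHermitian
  have hH1 : (traceLeft (toProd3 σ)).IsHermitian := (posSemidef_traceLeft hρ.1).isHermitian
  have e1 : vonNeumannEntropy (spinPartialTrace (embAS A S B) σ) = vonNeumannEntropy (traceLast (toProd3 σ)) := by
    rw [spinPartialTrace_embAS_eq_traceLast]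
    exact vonNeumannEntropy_submatrix_equiv hH3 _
  have e3 : vonNeumannEntropy (spinPartialTrace (Function.Embedding.inr : S ⊕ B ↪ A ⊕ (S ⊕ B)) σ) =
      vonNeumannEntropy (traceLeft (toProd3 σ)) := by
    rw [spinPartialTrace_inr_eq_traceLeft]
    exact vonNeumannEntropy_submatrix_equiv hH1 _
  have key := entropy_increment_nonneg_of_weak_monotonicity weak_monotonicity_holds (toProd3 σ) hρ
    (by rw [← e3, hAS, e1])
    (by rw [← spinPartialTrace_embB_eq_traceLeft_traceLeft, hB, spinPartialTrace_inl_eq_traceRight_traceLast])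
  rwa [e1, spinPartialTrace_inl_eq_traceRight_traceLast]

/-! ### Transport to an arbitrary site type partitioned into three blocks -/

omit [Fintype C] [DecidableEq C] in
/-- Relabelling the sites does not change the entropy of a (Hermitian) state ("the entropy is determined
completely by the eigenvalues"). [cite: NielsenChuang2010, Theorem 11.8 (3) (proof) p.513] -/
theorem vonNeumannEntropy_reindexOp {Y : Type} [Fintype Y] [DecidableEq Y] (e : X ≃ Y) {M : Op X q}
    (hM : M.IsHermitian) : vonNeumannEntropy (reindexOp e M) = vonNeumannEntropy M :=
  vonNeumannEntropy_submatrix_equiv hM (Equiv.arrowCongr e (Equiv.refl (Fin q))).symm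

/-- **Nonnegativity of the entropy increment, for a window on any site type.** Same statement as
`entropy_increment_nonneg_of_shift_invariant` for a state `σ` on a site type `Y` identified with a
three-block window by `ε : Y ≃ A ⊕ (S ⊕ B)`, the four sub-windows being given by site embeddings
`φA, φAS, φSB, φB` into `Y` that `ε` carries to the standard blocks (hypotheses `hA, hAS, hSB, hB`;
`εAS, εSB` identify the two middle-sized sub-windows with `A ⊕ S`, `S ⊕ B`). For a chain:
`Y` = a `(2l−1)`-site window, `φAS` / `φSB` = its first / last `l` sites, `φA` / `φB` = its first /
last `l−1` sites; the two entropy hypotheses hold because a translation-invariant state has equal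
(relabelled) marginals on translated sub-windows. [cite: FawziFawziScalet2024Entropy, Theorem 4.1 (proof)]
[cite: NielsenChuang2010, Theorem 11.14 eq. (11.107) p.521] -/
theorem entropy_increment_nonneg_of_shift_invariant' {Y AS SB : Type} [Fintype Y] [DecidableEq Y]
    [Fintype AS] [DecidableEq AS] [Fintype SB] [DecidableEq SB]
    (ε : Y ≃ A ⊕ (S ⊕ B)) (εAS : AS ≃ A ⊕ S) (εSB : SB ≃ S ⊕ B)
    {φA : A ↪ Y} {φAS : AS ↪ Y} {φSB : SB ↪ Y} {φB : B ↪ Y}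
    (hA : φA = (Function.Embedding.inl : A ↪ A ⊕ (S ⊕ B)).trans ε.symm.toEmbedding)
    (hAS : φAS = (εAS.toEmbedding.trans (embAS A S B)).trans ε.symm.toEmbedding)
    (hSB : φSB = (εSB.toEmbedding.trans (Function.Embedding.inr : S ⊕ B ↪ A ⊕ (S ⊕ B))).trans
      ε.symm.toEmbedding)
    (hB : φB = (embB A S B).trans ε.symm.toEmbedding)
    (σ : Op Y q) (hσ : σ.PosSemidef) (htr : σ.trace = 1)
    (h1 : vonNeumannEntropy (spinPartialTrace φSB σ) = vonNeumannEntropy (spinPartialTrace φAS σ))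
    (h2 : vonNeumannEntropy (spinPartialTrace φB σ) = vonNeumannEntropy (spinPartialTrace φA σ)) :
    0 ≤ vonNeumannEntropy (spinPartialTrace φAS σ) - vonNeumannEntropy (spinPartialTrace φA σ) := by
  -- move `σ` to the standard three-block window
  set σ' : Op (A ⊕ (S ⊕ B)) q := reindexOp ε σ with hσ'
  have hre : spinPartialTrace ε.symm.toEmbedding σ = σ' := by
    rw [hσ', spinPartialTrace_equiv, Equiv.symm_symm]
  have hσ'psd : σ'.PosSemidef := by rw [← hre]; exact posSemidef_spinPartialTrace _ hσ
  have hσ'tr : σ'.trace = 1 := by rw [hσ', trace_reindexOp, htr]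
  -- the four marginals of `σ` are (relabelled) marginals of `σ'`
  have eA : spinPartialTrace φA σ = spinPartialTrace (Function.Embedding.inl : A ↪ A ⊕ (S ⊕ B)) σ' := by
    rw [hA, spinPartialTrace_trans, hre]
  have eB : spinPartialTrace φB σ = spinPartialTrace (embB A S B) σ' := by
    rw [hB, spinPartialTrace_trans, hre]
  have eAS : spinPartialTrace φAS σ = reindexOp εAS.symm (spinPartialTrace (embAS A S B) σ') := by
    rw [hAS, spinPartialTrace_trans, spinPartialTrace_trans, hre, spinPartialTrace_equiv]
  have eSB : spinPartialTrace φSB σ =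
      reindexOp εSB.symm (spinPartialTrace (Function.Embedding.inr : S ⊕ B ↪ A ⊕ (S ⊕ B)) σ') := by
    rw [hSB, spinPartialTrace_trans, spinPartialTrace_trans, hre, spinPartialTrace_equiv]
  have hHAS : (spinPartialTrace (embAS A S B) σ').IsHermitian :=
    isHermitian_spinPartialTrace _ hσ'psd.isHermitian
  have hHSB : (spinPartialTrace (Function.Embedding.inr : S ⊕ B ↪ A ⊕ (S ⊕ B)) σ').IsHermitian :=
    isHermitian_spinPartialTrace _ hσ'psd.isHermitian
  rw [eAS, vonNeumannEntropy_reindexOp εAS.symm hHAS, eA]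
  rw [eSB, vonNeumannEntropy_reindexOp εSB.symm hHSB, eAS, vonNeumannEntropy_reindexOp εAS.symm hHAS] at h1
  rw [eB, eA] at h2
  exact entropy_increment_nonneg_of_shift_invariant σ' hσ'psd hσ'tr h1 h2

/-! ### The chain form: a `(n + 1 + n)`-site window indexed by `Fin` -/

section FinWindow

variable (n : ℕ)

/-- The site bijection `Fin (n + 1 + n) ≃ Fin n ⊕ (Fin 1 ⊕ Fin n)`: first `n` sites | middle site |
last `n` sites of the `(2n+1)`-site chain window `[1, 2l−1]`, `l = n + 1`.
[cite: FawziFawziScalet2024Entropy, Theorem 4.1 (proof)] -/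
def finWindowSplit : Fin (n + 1 + n) ≃ Fin n ⊕ (Fin 1 ⊕ Fin n) :=
  finSumFinEquiv.symm.trans
    ((Equiv.sumCongr finSumFinEquiv.symm (Equiv.refl (Fin n))).trans (Equiv.sumAssoc (Fin n) (Fin 1) (Fin n)))

/-- The last `l = n+1` sites of `Fin (n+1)` identified with (middle site) ⊕ (last `n` sites).
[cite: FawziFawziScalet2024Entropy, Theorem 4.1 (proof)] -/
def finSuccSplit : Fin (n + 1) ≃ Fin 1 ⊕ Fin n :=
  (finCongr (Nat.add_comm n 1)).trans finSumFinEquiv.symm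

/-- Sub-window `[1, l−1]` (first `n` sites). [cite: FawziFawziScalet2024Entropy, Theorem 4.1 (proof)] -/
def finFirst : Fin n ↪ Fin (n + 1 + n) :=
  (Function.Embedding.inl : Fin n ↪ Fin n ⊕ (Fin 1 ⊕ Fin n)).trans (finWindowSplit n).symm.toEmbedding

/-- Sub-window `[1, l]` (first `n+1` sites). [cite: FawziFawziScalet2024Entropy, Theorem 4.1 (proof)] -/
def finFirstSucc : Fin (n + 1) ↪ Fin (n + 1 + n) :=
  ((finSumFinEquiv.symm : Fin (n + 1) ≃ Fin n ⊕ Fin 1).toEmbedding.trans (embAS (Fin n) (Fin 1) (Fin n))).trans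
    (finWindowSplit n).symm.toEmbedding

/-- Sub-window `[l, 2l−1]` (last `n+1` sites). [cite: FawziFawziScalet2024Entropy, Theorem 4.1 (proof)] -/
def finLastSucc : Fin (n + 1) ↪ Fin (n + 1 + n) :=
  ((finSuccSplit n).toEmbedding.trans (Function.Embedding.inr : Fin 1 ⊕ Fin n ↪ Fin n ⊕ (Fin 1 ⊕ Fin n))).trans
    (finWindowSplit n).symm.toEmbedding

/-- Sub-window `[l+1, 2l−1]` (last `n` sites). [cite: FawziFawziScalet2024Entropy, Theorem 4.1 (proof)] -/
def finLast : Fin n ↪ Fin (n + 1 + n) :=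
  (embB (Fin n) (Fin 1) (Fin n)).trans (finWindowSplit n).symm.toEmbedding

/-- The first two blocks of `finWindowSplit` land on `Fin.castAdd n`. [folklore] -/
private theorem finWindowSplit_symm_inl (y : Fin n ⊕ Fin 1) :
    (finWindowSplit n).symm (Sum.inl y |> fun z => (Equiv.sumAssoc (Fin n) (Fin 1) (Fin n)) z) =
      Fin.castAdd n (finSumFinEquiv y) := by
  simp [finWindowSplit]

/-- `finFirstSucc n i = Fin.castAdd n i` (sites `0 … n`). [cite: FawziFawziScalet2024Entropy, Theorem 4.1 (proof)] -/
@[simp] theorem finFirstSucc_apply (i : Fin (n + 1)) : finFirstSucc n i = Fin.castAdd n i := by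
  have h := finWindowSplit_symm_inl n (finSumFinEquiv.symm i)
  rw [Equiv.apply_symm_apply] at h
  rw [← h]
  simp only [finFirstSucc, Function.Embedding.trans_apply, Equiv.coe_toEmbedding]
  congr 1

/-- `finFirst n i = Fin.castAdd n (Fin.castAdd 1 i)` (sites `0 … n−1`). [cite: FawziFawziScalet2024Entropy, Theorem 4.1 (proof)] -/
@[simp] theorem finFirst_apply (i : Fin n) : finFirst n i = Fin.castAdd n (Fin.castAdd 1 i) := by
  have h := finWindowSplit_symm_inl n (Sum.inl i)
  rw [finSumFinEquiv_apply_left] at h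
  rw [← h]
  simp only [finFirst, Function.Embedding.trans_apply, Equiv.coe_toEmbedding, Function.Embedding.inl_apply]
  congr 1

/-- `finLast n i = Fin.natAdd (n+1) i` (sites `n+1 … 2n`). [cite: FawziFawziScalet2024Entropy, Theorem 4.1 (proof)] -/
@[simp] theorem finLast_apply (i : Fin n) : finLast n i = Fin.natAdd (n + 1) i := by
  simp [finLast, finWindowSplit, embB]

/-- `finLastSucc n i` is site `n + i` (sites `n … 2n`). [cite: FawziFawziScalet2024Entropy, Theorem 4.1 (proof)] -/
@[simp] theorem coe_finLastSucc_apply (i : Fin (n + 1)) : ((finLastSucc n i : Fin (n + 1 + n)) : ℕ) = n + i := by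
  show (((finWindowSplit n).symm (Sum.inr (finSuccSplit n i)) : Fin (n + 1 + n)) : ℕ) = n + i
  have hv : ((finSumFinEquiv (finSuccSplit n i) : Fin (1 + n)) : ℕ) = i := by
    simp [finSuccSplit]
  rcases hz : finSuccSplit n i with s | b
  · have hs : s = 0 := Subsingleton.elim _ _
    subst hs
    rw [hz, finSumFinEquiv_apply_left, Fin.val_castAdd, Fin.val_zero] at hv
    have h0 : (((finWindowSplit n).symm (Sum.inr (Sum.inl (0 : Fin 1))) : Fin (n + 1 + n)) : ℕ) = n := by
      simp [finWindowSplit]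
    rw [h0]
    omega
  · rw [hz, finSumFinEquiv_apply_right, Fin.val_natAdd] at hv
    simp [finWindowSplit]
    omega

/-- **Nonnegativity of the entropy increment, chain form.** For a density `σ` on the `(2l−1)`-site
window `Fin (n + 1 + n)` (`l = n + 1`) whose first- and last-`l`-site marginals have equal entropy and
whose first- and last-`(l−1)`-site marginals have equal entropy (e.g. the window marginal of a
translation-invariant chain state): `0 ≤ S(σ_{[1,l]}) − S(σ_{[1,l−1]})`.
[cite: FawziFawziScalet2024Entropy, Theorem 4.1 (proof)] [cite: NielsenChuang2010, Theorem 11.14 eq. (11.107) p.521] -/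
theorem entropy_increment_nonneg_of_shift_invariant_fin (σ : Op (Fin (n + 1 + n)) q) (hσ : σ.PosSemidef)
    (htr : σ.trace = 1)
    (h1 : vonNeumannEntropy (spinPartialTrace (finLastSucc n) σ) =
      vonNeumannEntropy (spinPartialTrace (finFirstSucc n) σ))
    (h2 : vonNeumannEntropy (spinPartialTrace (finLast n) σ) = vonNeumannEntropy (spinPartialTrace (finFirst n) σ)) :
    0 ≤ vonNeumannEntropy (spinPartialTrace (finFirstSucc n) σ) -
      vonNeumannEntropy (spinPartialTrace (finFirst n) σ) :=
  entropy_increment_nonneg_of_shift_invariant' (finWindowSplit n) finSumFinEquiv.symm (finSuccSplit n)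
    rfl rfl rfl rfl σ hσ htr h1 h2

end FinWindow

end Literature.MathematicalPhysics.QuantumLattice
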